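import Literature.NumberTheory.ComplexMultiplication.MainTheoremOfComplexMultiplication
import Literature.AlgebraicGeometry.ShimuraVarieties.UnitaryShimuraCanonicalModel
import Literature.NumberTheory.NumberFields.IdelicArtinMapKernel
import HarnessLib

/-!
# «`σ = [s, M]` on `M_ab`» (Shimura) versus «`art_M(s) = σ|M^ab`» (Milne–Deligne): the two Artin conventions of the cell

Topic `Literature/NumberTheory/ComplexMultiplication`, namespace `Literature.NumberTheory.ComplexMultiplication`.
Cell `hodgecm-mathlib` (D-0151): the ADAPTER named by the ref2 audits of B-II row II-1 (AUDIT-B-MainTheoremOfCM n2) and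
of D3 (AUDIT-B-DeterminesHeckeCharacter n1), so that the `h21`-side reciprocity (`IsArtinLift`, rows II-1/D3: Shimura's
`[s, M]`, ARITHMETIC normalisation, FULL idèle `s`) and the `hDel`-side reciprocity
(`UnitaryCanonicalModel.IsArtinCorrespondent`, binder F1/F3: Milne's `art_M = rec_M⁻¹`, GEOMETRIC normalisation, FINITE
idèle) meet in one PROVED lemma.  No named facts.

THE TWO CONVENTIONS.  Both predicates say: «for some `M`-embedding `e : M̄ → ℂ` the automorphism `σ` of `ℂ` restricts
along `e` to a `γ ∈ Gal(M̄/M)` whose class in `Gal(M̄/M)^ab` is …» — for `IsArtinLift M s σ` the class is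
`NumberFields.ideleArtinMap M s = θ_M(s mod M^×)`, the tree's universal norm-residue symbol (a prime element at an
unramified `v` ↦ the ARITHMETIC Frobenius: Shimura §18.3 «`[a, M]`», Tate), for `IsArtinCorrespondent M τ t σ` it is
`θ_M((1_∞, t) mod M^×)⁻¹` (Milne ISV (59) «`art_E(α) = rec_E(α)⁻¹`», Deligne 1979 0.8 «uniformiser ↦ geometric
Frobenius»).  Hence (`isArtinCorrespondent_iff_isArtinLift`): `IsArtinCorrespondent M (algebraMap M ℂ) t σ ↔
IsArtinLift M (1_∞, t)⁻¹ σ` for every finite idèle `t`, with NO hypothesis on `M`; and since for a totally imaginary `M`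
(every CM field) the archimedean part `M_∞^×` is connected and dies under `[·, M]`
(`NumberFields.ideleArtinMap_infiniteIdeles`, Shimura §18.3 p. 122), `[s, M] = [(1_∞, s_𝐡), M]` and so
(`isArtinLift_iff_isArtinCorrespondent`): `IsArtinLift M s σ ↔ IsArtinCorrespondent M (algebraMap M ℂ) (s_𝐡)⁻¹ σ` —
Shimura's `s` corresponds to Milne's `s_𝐡⁻¹` (the «`s ↦ s⁻¹` relative to Shimura» recorded in the II-1 docstring and in
Milne ISV Thm. 11.2 vs Shimura Thm. 18.6).  The only non-bookkeeping point is that the two predicates quantify over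
`M`-algebra embeddings `M̄ →ₐ[M] ℂ` for two (propositionally equal, not syntactically equal) `M`-algebra structures on
`ℂ` (`IsArtinCorrespondent` installs `τ.toAlgebra`); both are therefore first rewritten as statements about ring
homomorphisms `f : M̄ →+* ℂ` with `f ∘ (M → M̄) = τ` (`isArtinLift_iff_exists_ringHom`,
`isArtinCorrespondent_iff_exists_ringHom`).

## References

* [Shimura1998] G. Shimura, *Abelian Varieties with Complex Multiplication and Modular Functions*, Princeton 1998,
  §18.3 p. 122 («[a, M]»; the kernel contains the identity component of `M_𝐚^×`), §18.6 Thm. 18.6 p. 127.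
* [Milne2005ShimuraVarieties] J. S. Milne, *Introduction to Shimura varieties*, (59) p. 107 («art_E = rec_E⁻¹»),
  Thm. 11.2 p. 108.
* [Deligne1979ShimuraVarieties] P. Deligne, *Variétés de Shimura*, 0.8 (uniformiser ↦ geometric Frobenius).
-/

noncomputable section

open scoped Classical nonZeroDivisors NumberField
open NumberField IsDedekindDomain

namespace Literature.NumberTheory.ComplexMultiplication

open Literature.NumberTheory.GaloisRepresentations (ideleGroup absGaloisAbProj infiniteIdeles
  isGlobalReciprocitySystem_artinMap)
open Literature.NumberTheory (GaloisRepresentations.principalIdeles)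
open Literature.NumberTheory.NumberFields (ideleArtinMap ideleArtinMap_apply ideleArtinMap_infiniteIdeles
  eq_infiniteIdeles_mul_finiteIdeles)
open Literature.NumberTheory.NumberFields.IdeleAction (finitePart)
open Literature.AlgebraicGeometry.ShimuraVarieties.UnitaryCanonicalModel (IsArtinCorrespondent finiteIdeleClass)

variable {M : Type} [Field M] [NumberField M]

/-! ### Both predicates as statements about ring homomorphisms `M̄ →+* ℂ` -/

omit [NumberField M] in
/-- Bookkeeping: an existential over `M`-algebra homomorphisms `M̄ →ₐ[M] ℂ` for an `M`-algebra structure `I` on `ℂ`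
is an existential over ring homomorphisms `f : M̄ →+* ℂ` with `f ∘ (M → M̄) = algebraMap` (of `I`). [folklore] -/
private theorem exists_algHom_iff_exists_ringHom {I : Algebra M ℂ} (P : (AlgebraicClosure M → ℂ) → Prop) :
    (∃ e : @AlgHom M (AlgebraicClosure M) ℂ _ _ _ _ I, P e) ↔
      ∃ f : AlgebraicClosure M →+* ℂ,
        f.comp (algebraMap M (AlgebraicClosure M)) = @algebraMap M ℂ _ _ I ∧ P f := by
  letI := I
  constructor
  · rintro ⟨e, he⟩
    exact ⟨(e : AlgebraicClosure M →+* ℂ), e.comp_algebraMap, he⟩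
  · rintro ⟨f, hf, hP⟩
    exact ⟨⟨f, fun r => RingHom.congr_fun hf r⟩, hP⟩

/-- **`IsArtinLift` without the `M`-algebra packaging**: `σ = [s, M]` on `M_ab` iff for some ring homomorphism
`f : M̄ → ℂ` extending `M ⊂ ℂ` and some `γ ∈ Gal(M̄/M)` with `f ∘ γ = σ ∘ f`, the class of `γ` in `Gal(M̄/M)^ab` is
`[s, M]`. [cite: Shimura1998, §18.3 p. 122 («[a, M]»); §18.6 Thm. 18.6 p. 127 («σ = [s, K*] on K*_ab»)] -/
theorem isArtinLift_iff_exists_ringHom [Algebra M ℂ] (s : ideleGroup M) (σ : ℂ ≃ₐ[M] ℂ) :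
    IsArtinLift M s σ ↔
      ∃ f : AlgebraicClosure M →+* ℂ, f.comp (algebraMap M (AlgebraicClosure M)) = algebraMap M ℂ ∧
        ∃ γ : Field.absoluteGaloisGroup M,
          (∀ x : AlgebraicClosure M, f (Field.absoluteGaloisGroup.toAlgEquiv M γ x) = σ (f x)) ∧
            absGaloisAbProj M γ = ideleArtinMap M s := by
  unfold IsArtinLift
  exact exists_algHom_iff_exists_ringHom (I := inferInstance) fun f =>
    ∃ γ : Field.absoluteGaloisGroup M,
      (∀ x : AlgebraicClosure M, f (Field.absoluteGaloisGroup.toAlgEquiv M γ x) = σ (f x)) ∧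
        absGaloisAbProj M γ = ideleArtinMap M s

/-- **`IsArtinCorrespondent` without the `M`-algebra packaging**: `σ` and the finite idèle `t` correspond under
Milne's `art_M` along `τ : M → ℂ` iff for some ring homomorphism `f : M̄ → ℂ` extending `τ` and some `γ ∈ Gal(M̄/M)` with
`f ∘ γ = σ ∘ f`, the class of `γ` is `θ_M((1_∞, t) mod M^×)⁻¹`. [cite: Milne2005ShimuraVarieties, (59) p. 107 («art_E(α) = rec_E(α)⁻¹»)] -/
theorem isArtinCorrespondent_iff_exists_ringHom [IsCMField M] (τ : M →+* ℂ)
    (t : (FiniteAdeleRing (𝓞 M) M)ˣ) (σ : ℂ ≃+* ℂ) :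
    IsArtinCorrespondent M τ t σ ↔
      ∃ f : AlgebraicClosure M →+* ℂ, f.comp (algebraMap M (AlgebraicClosure M)) = τ ∧
        ∃ γ : Field.absoluteGaloisGroup M,
          (∀ x : AlgebraicClosure M, f (Field.absoluteGaloisGroup.toAlgEquiv M γ x) = σ (f x)) ∧
            absGaloisAbProj M γ = ((isGlobalReciprocitySystem_artinMap M).theta (finiteIdeleClass M t))⁻¹ := by
  unfold IsArtinCorrespondent
  exact exists_algHom_iff_exists_ringHom (I := τ.toAlgebra) fun f =>
    ∃ γ : Field.absoluteGaloisGroup M,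
      (∀ x : AlgebraicClosure M, f (Field.absoluteGaloisGroup.toAlgEquiv M γ x) = σ (f x)) ∧
        absGaloisAbProj M γ = ((isGlobalReciprocitySystem_artinMap M).theta (finiteIdeleClass M t))⁻¹

/-! ### The idèle-class bookkeeping: `θ_M((1_∞, t) mod M^×) = [(1_∞, t), M]`, and `[s, M] = [(1_∞, s_𝐡), M]` -/

variable (M) in
/-- **The finite idèles inside the idèles, `M_𝐡^× ↪ M_𝐀^×`, `t ↦ (1_∞, t)`** (Shimura §18.3: `M_𝐀^× = M_𝐚^× M_𝐡^×`,
«`x = x_𝐚 x_𝐡`»); the companion of the tree's `GaloisRepresentations.infiniteIdeles` (`y ↦ (y, 1_𝐡)`), spelled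
`Units.map (MonoidHom.inr …)` in `NumberFields.eq_infiniteIdeles_mul_finiteIdeles`.
[cite: Shimura1998, §18.3 pp. 121–122 («x_𝐚», «x_𝐡»)] -/
def finiteIdeles : (FiniteAdeleRing (𝓞 M) M)ˣ →* ideleGroup M :=
  Units.map (N := AdeleRing (𝓞 M) M) (MonoidHom.inr (InfiniteAdeleRing M) (FiniteAdeleRing (𝓞 M) M))

/-- `(1_∞, t)_𝐡 = t`. [cite: Shimura1998, §18.3 pp. 121–122 («x_𝐡»)] -/
@[simp]
theorem finitePart_finiteIdeles (t : (FiniteAdeleRing (𝓞 M) M)ˣ) : finitePart M (finiteIdeles M t) = t :=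
  Units.ext rfl

/-- **`s = s_𝐚 · (1_∞, s_𝐡)`** (the tree's `eq_infiniteIdeles_mul_finiteIdeles`, restated with `finiteIdeles`).
[cite: Shimura1998, §18.3 pp. 121–122 («x = x_𝐚 x_𝐡»)] -/
theorem eq_infiniteIdeles_mul_finiteIdeles_finitePart (s : ideleGroup M) :
    s = infiniteIdeles M (Units.map (RingHom.fst (InfiniteAdeleRing M) (FiniteAdeleRing (𝓞 M) M)).toMonoidHom s) *
      finiteIdeles M (finitePart M s) :=
  eq_infiniteIdeles_mul_finiteIdeles (K := M) s

/-- Milne's finite idèle class `(1_∞, t) mod M^×` (`UnitaryCanonicalModel.finiteIdeleClass`) is the class of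
`finiteIdeles M t`. [cite: Milne2005ShimuraVarieties, (59) p. 107] -/
theorem finiteIdeleClass_eq_mk [IsCMField M] (t : (FiniteAdeleRing (𝓞 M) M)ˣ) :
    finiteIdeleClass M t = (QuotientGroup.mk (finiteIdeles M t) : ideleGroup M ⧸ GaloisRepresentations.principalIdeles M) :=
  rfl

/-- `θ_M` at the class of the finite idèle `t` (archimedean components `1`) is `[(1_∞, t), M]` (same map:
`NumberFields.ideleArtinMap = θ_M ∘ (mod M^×)`). [cite: Shimura1998, §18.3 p. 122 («[a, M]»)] [cite: Milne2005ShimuraVarieties, (59) p. 107] -/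
theorem theta_finiteIdeleClass [IsCMField M] (t : (FiniteAdeleRing (𝓞 M) M)ˣ) :
    (isGlobalReciprocitySystem_artinMap M).theta (finiteIdeleClass M t) = ideleArtinMap M (finiteIdeles M t) :=
  rfl

/-- **`[s, M] = [(1_∞, s_𝐡), M]` for `M` totally imaginary**: `s = s_𝐚 · (1_∞, s_𝐡)` and `[s_𝐚, M] = 1` because
`M_𝐚^×` is connected and the kernel of `[·, M]` contains the identity component (`ideleArtinMap_infiniteIdeles`).
[cite: Shimura1998, §18.3 p. 122 (kernel of [·, M] ⊇ identity component of M_𝐚^×)] -/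
theorem ideleArtinMap_eq_ideleArtinMap_finitePart [IsTotallyComplex M] (s : ideleGroup M) :
    ideleArtinMap M s = ideleArtinMap M (finiteIdeles M (finitePart M s)) := by
  conv_lhs => rw [eq_infiniteIdeles_mul_finiteIdeles_finitePart s]
  rw [map_mul, ideleArtinMap_infiniteIdeles, one_mul]

/-- `IsArtinLift M s σ` depends on `s` only through `[s, M]`. [cite: Shimura1998, §18.3 p. 122 («[a, M]»)] -/
theorem isArtinLift_congr [Algebra M ℂ] {s s' : ideleGroup M} (h : ideleArtinMap M s = ideleArtinMap M s')
    (σ : ℂ ≃ₐ[M] ℂ) : IsArtinLift M s σ ↔ IsArtinLift M s' σ := by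
  unfold IsArtinLift
  rw [h]

/-! ### The adapter -/

/-- **Milne's correspondent of `σ` is Shimura's, inverted (finite-idèle form, any CM field `M ⊂ ℂ`)**: for a finite
idèle `t` of `M` and `σ ∈ Aut(ℂ/M)`, `IsArtinCorrespondent M (M ⊂ ℂ) t σ` («`art_M(t) = σ|M^ab`», `art = rec⁻¹`) iff
`IsArtinLift M (1_∞, t)⁻¹ σ` («`σ = [(1_∞, t)⁻¹, M]` on `M_ab`»).  Pure bookkeeping: `θ_M(t̄)⁻¹ = θ_M(t̄⁻¹) = [(1_∞, t)⁻¹, M]`.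
[cite: Milne2005ShimuraVarieties, (59) p. 107 («art_E(α) = rec_E(α)⁻¹»); Thm. 11.2 p. 108] [cite: Shimura1998, §18.3 p. 122; §18.6 Thm. 18.6 p. 127] -/
theorem isArtinCorrespondent_iff_isArtinLift [IsCMField M] [Algebra M ℂ] (t : (FiniteAdeleRing (𝓞 M) M)ˣ)
    (σ : ℂ ≃ₐ[M] ℂ) :
    IsArtinCorrespondent M (algebraMap M ℂ) t σ.toRingEquiv ↔ IsArtinLift M (finiteIdeles M t)⁻¹ σ := by
  rw [isArtinCorrespondent_iff_exists_ringHom, isArtinLift_iff_exists_ringHom, theta_finiteIdeleClass, ← map_inv]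
  simp only [AlgEquiv.coe_ringEquiv]

/-- **THE ADAPTER `IsArtinLift ↔ IsArtinCorrespondent` (ref2 AUDIT-B-MainTheoremOfCM n2): for a CM field `M ⊂ ℂ`, a FULL
idèle `s` and `σ ∈ Aut(ℂ/M)`, Shimura's «`σ = [s, M]` on `M_ab`» holds iff Milne's «`art_M(s_𝐡⁻¹) = σ|M^ab`» does** —
`θ` versus `θ⁻¹` (arithmetic versus geometric normalisation) and full idèle versus finite idèle (the archimedean part
of the totally imaginary `M` dies: `ideleArtinMap_eq_ideleArtinMap_finitePart`).  With this, the `h21`-side hypotheses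
(`shimura1998_thm18_6`, `SatisfiesShimuraReciprocity`) and the `hDel`-side hypothesis (F1/F3 `IsArtinCorrespondent`) are
interchangeable: Shimura's `s` is Milne's `s_𝐡⁻¹`.
[cite: Shimura1998, §18.3 p. 122; §18.6 Thm. 18.6 p. 127] [cite: Milne2005ShimuraVarieties, (59) p. 107; Thm. 11.2 p. 108 (art = rec⁻¹, hence s ↦ s⁻¹ relative to Shimura)] -/
theorem isArtinLift_iff_isArtinCorrespondent [IsCMField M] [Algebra M ℂ] (s : ideleGroup M) (σ : ℂ ≃ₐ[M] ℂ) :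
    IsArtinLift M s σ ↔ IsArtinCorrespondent M (algebraMap M ℂ) (finitePart M s)⁻¹ σ.toRingEquiv := by
  haveI : IsTotallyComplex M := IsCMField.to_isTotallyComplex
  rw [isArtinCorrespondent_iff_isArtinLift, map_inv, inv_inv,
    isArtinLift_congr (ideleArtinMap_eq_ideleArtinMap_finitePart s)]

end Literature.NumberTheory.ComplexMultiplication

end
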